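import Summits.QuantumFields.BalabanUV.Beta.EriceFlowEnclosureB12AsPrintedPointwiseFadingOrderSharpFold

/-!
# Beta / EriceFlowEnclosureB12AsPrintedPointwiseFadingOrderSharpFoldEnd — WHAT (0.31) FORCES POINTWISE, part 7♯ END: **THE SHARP THRESHOLD FOR UNIQUENESS IS 2(1 − √θ)² TOO.**
# Node U2's `T4TwoRunUniqueness.eq_of_pin_fadingMemory_rho` (at ρ′ = 1∕√θ) and `…Sharp.runs_eq_of_fadingMemory_sqrt`: under `HistLipschitz Λ γ β` + `FadingMemory C θ Λ` (0 < θ < 1) two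
# same-length runs of (0.20) in a box ]0, γ] with Cγ³ ≤ 2(1 − √θ)² (resp. <) and the same endpoint COINCIDE — «g₀ = g₀(ε, g)» is a function.  HERE (**`nonunique_above_edge`**): for every
# 0 < θ < 1 and EVERY c > 2(1 − √θ)² there are C ≥ 0, γ > 0 with Cγ³ ≤ c, Λ with `FadingMemory C θ Λ`, a β with `HistLipschitz Λ γ β` (the clamp family), a depth K and two runs g, g′ of
# (0.20) of length K inside ]0, γ] with **g_0 < g′_0 and g_K = g′_K** — two DIFFERENT bare couplings, ONE renormalized coupling.  So prover 1's question (bflow-p1 gen 35 NEXT (A), «the sharp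
# box-vs-modulus threshold t(θ) for reference-free uniqueness; (1−θ)²∕4 ≤ t(θ), t(½) ≤ 3∕2, conjecturally ≍ 2(1−√θ)²») is answered EXACTLY: **t(θ) = 2(1 − √θ)²** for every 0 < θ < 1, for
# uniqueness as for order (`…SharpThreshold.orderBox_iff`); their folds (#63d: Cγ³ = 6 Markov; #63f: 3∕2 at θ = ½) were upper data 8.7× resp. 8.7× above the truth at θ = ½ (0.1716).
# MECHANISM.  Constants C, τ₁ of `constants_exist` (box γ = 1 + τ₁, C(1+τ₁)³ ≤ c, band coefficient at τ₁ above the edge ⟹ p := 1 + θ − C(1−τ₁)²∕(2+τ₁) < 2√θ ⟹ reversal depth N = n + 1,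
# `oscillation_fin`); clamp width τ := min(τ₁, τ₁(1−θ)∕(N·C)) so that the universal drift N·Cτ∕(1−θ) ≤ τ₁ (`…SharpFold.beta_abs_le ∕ crudeRun`: every run started in [½, 1] exists to depth N
# and stays in ]0, 1 + τ₁]); the band run of `clampRun` started at s₀ = 1∕√(1+δ₀) is reversed at some j ≤ N (g_j(s₀) ≥ 1, two-term inequality weakened from τ to τ₁ by `coeffLower_antitone`), the
# run started at ½ has g_j(½) < 1 (drift ≤ ¾ in the chart from 4), s ↦ g_j(s) is continuous on [½, s₀] (`tbl_continuousOn`) ⟹ `intermediate_value_Icc` gives s* ∈ [½, s₀] with g_j(s*) = 1 = the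
# constant run's value, s* ≤ s₀ < 1
# (β-flow team, prover 2 = lower ∕ positivity side, unit `b2b-balaban-beta-bflow-p2`, gen 45; ROW AP-I × node U2's letters and `T4TwoRunUniqueness` §3; a TOY FAMILY of ours)

HONEST FRAMING (page 1 of everything the β sub-cell writes): discharging `BetaPertH` makes Bałaban's UV stability UNCONDITIONAL — a
real constructive-QFT result; it is NOT the continuum limit and NOT the Clay problem.  HONEST DEPENDENCY (cell reorg 2026-08-19,
verbatim): «continuum YM on T⁴ ⇐ BetaPertH ∧ nine spine estimates (0/9 proved); BetaPertH ⇐ (D1) ∧ (D4) ∧ CAP+tail; G-an2-4 gates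
asym, D1 and NE2/3/4.»  THIS MODULE DISCHARGES NOTHING: it is elementary real analysis about an EXPLICIT TOY family (ours — NOT Bałaban's β of
[I] = T. Bałaban, Commun. Math. Phys. **109** (1987) [Balaban1987RG1] (1.22) p. 264) and the forward solutions of the recursion (0.20) p. 256 for it; node U2's
`HistLipschitz` ∕ `FadingMemory` are UNPRINTED hypothesis shapes (GAPS G-t4-U2-2; p. 298).  It says NOTHING about whether Bałaban's β has fading memory or about the size
of its box; uniqueness of g₀ is NOT printed (Theorem 2 p. 259 is an existence statement, STATED WITHOUT PROOF — custodian's DELTA-I D-21): where it holds it is the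
consumer's theorem, and this module says exactly how small the consumer's box must be under node U2's letters.

WHAT THIS FILE PROVES (0 sorry, 0 def): **`nonunique_above_edge`**, **`uniqueBox_iff`**.
NOT CLAIMED: anything about Bałaban's β; the boundary value at θ = 0; Theorem 2; `BetaPertH`; continuum; Clay.
-/

namespace Summit.QuantumFields.BalabanUV.Beta.EriceFlowEnclosureB12AsPrintedPointwiseFadingOrderSharpFoldEnd

open Finset Set
open Literature.MathematicalPhysics.QuantumFieldTheory.Balaban1983to89
open Literature.MathematicalPhysics.QuantumFieldTheory.Balaban1983to89.FlowStep (HBeta prefixOf Box mem_box RGEqH)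
open Literature.MathematicalPhysics.QuantumFieldTheory.Balaban1983to89.T4CouplingMatching (HistLipschitz FadingMemory)
open Summit.QuantumFields.BalabanUV.Beta.EriceFlowEnclosureB12AsPrintedPointwiseFadingOrderSharp (runs_eq_of_fadingMemory_sqrt)
open Summit.QuantumFields.BalabanUV.Beta.EriceFlowEnclosureB12AsPrintedPointwiseFadingOrderSharpOscillation (oscillation_fin)
open Summit.QuantumFields.BalabanUV.Beta.EriceFlowEnclosureB12AsPrintedPointwiseFadingOrderSharpWitness
open Summit.QuantumFields.BalabanUV.Beta.EriceFlowEnclosureB12AsPrintedPointwiseFadingOrderSharpWitnessEnd (constants_exist depth_exists clampRun)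
open Summit.QuantumFields.BalabanUV.Beta.EriceFlowEnclosureB12AsPrintedPointwiseFadingOrderSharpFold

noncomputable section

/-- **NON-UNIQUENESS INSIDE THE MODULI ABOVE THE EDGE — THE CONSTANT 2(1 − √θ)² OF `runs_eq_of_fadingMemory_sqrt` IS SHARP.**  For every 0 < θ < 1 and every c > 2(1 − √θ)² there are
C ≥ 0, γ > 0 with Cγ³ ≤ c, moduli Λ with `FadingMemory C θ Λ`, a history-dependent β with `HistLipschitz Λ γ β`, a depth K and two runs g, g′ of (0.20) of length K inside ]0, γ] with
g_0 < g′_0 and g_K = g′_K: two different bare couplings renormalize to the same coupling — «g₀ = g₀(ε, g)» is NOT a function there.  (Clamp family; g′ ≡ 1; g = the run started at the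
intermediate-value point s* ∈ [½, s₀] of s ↦ g_j(s) between the far start ½ (g_j < 1) and the reversed band start s₀ (g_j ≥ 1).) [cite: Balaban1987RG1, (0.20) p.256 with p.298 and Thm 2 p.259 («g₀ = g₀(ε, g)»)] -/
theorem nonunique_above_edge {θ c : ℝ} (hθ0 : 0 < θ) (hθ1 : θ < 1) (hc : 2 * (1 - Real.sqrt θ) ^ 2 < c) :
    ∃ (C γ : ℝ) (Λ : ℕ → ℕ → ℝ) (β : HBeta) (K : ℕ) (g g' : ℕ → ℝ),
      0 ≤ C ∧ 0 < γ ∧ C * γ ^ 3 ≤ c ∧ FadingMemory C θ Λ ∧ HistLipschitz Λ γ β ∧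
      RGEqH K β g ∧ RGEqH K β g' ∧ (∀ i, i ≤ K → 0 < g i ∧ g i ≤ γ) ∧ (∀ i, i ≤ K → 0 < g' i ∧ g' i ≤ γ) ∧
      g 0 < g' 0 ∧ g K = g' K := by
  obtain ⟨C, τ₁, hC0, hτ₁0, hτ₁4, hCγ, hcm⟩ := constants_exist hc
  -- the depth, computed at the clamp width τ₁
  set p : ℝ := 1 + θ - C * ((1 - τ₁) ^ 2 / (2 + τ₁)) with hp
  clear_value p
  have hsq : Real.sqrt θ ^ 2 = θ := Real.sq_sqrt hθ0.le
  have hp2 : p < 2 * Real.sqrt θ := by rw [hp]; nlinarith [hcm, hsq]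
  obtain ⟨n, hn1, hn⟩ := depth_exists (p ^ 2 / (θ - p ^ 2 / 4) + 1)
  have h1θ : 0 < 1 - θ := by linarith
  have hNpos : (0 : ℝ) < ((n + 1 : ℕ) : ℝ) := by positivity
  -- the clamp width: universal drift N·Cτ/(1−θ) ≤ τ₁
  set τ : ℝ := min τ₁ (τ₁ * (1 - θ) / (((n + 1 : ℕ) : ℝ) * C)) with hτ
  have hτ0 : 0 < τ := by rw [hτ]; exact lt_min hτ₁0 (by positivity)
  have hττ₁ : τ ≤ τ₁ := by rw [hτ]; exact min_le_left _ _
  have hτle : τ ≤ τ₁ * (1 - θ) / (((n + 1 : ℕ) : ℝ) * C) := by rw [hτ]; exact min_le_right _ _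
  clear_value τ
  have hτ1 : τ ≤ 1 := by linarith
  have hB0 : 0 ≤ C * τ / (1 - θ) := div_nonneg (mul_nonneg hC0.le hτ0.le) h1θ.le
  have hdrift : ((n + 1 : ℕ) : ℝ) * (C * τ / (1 - θ)) ≤ τ₁ := by
    have h := hτle
    calc ((n + 1 : ℕ) : ℝ) * (C * τ / (1 - θ)) = (((n + 1 : ℕ) : ℝ) * C / (1 - θ)) * τ := by ring
      _ ≤ (((n + 1 : ℕ) : ℝ) * C / (1 - θ)) * (τ₁ * (1 - θ) / (((n + 1 : ℕ) : ℝ) * C)) :=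
          mul_le_mul_of_nonneg_left h (by positivity)
      _ = τ₁ := by field_simp
  have hdrift34 : ((n + 1 : ℕ) : ℝ) * (C * τ / (1 - θ)) ≤ 3 / 4 := hdrift.trans (by linarith)
  -- the clamp family at width τ
  let βt : HBeta := fun k q => C * ∑ i : Fin (k + 1), θ ^ (k - (i : ℕ)) * max (-τ) (min τ (1 - q i))
  have hβ : ∀ (k : ℕ) (q : Fin (k + 1) → ℝ),
      βt k q = C * ∑ i : Fin (k + 1), θ ^ (k - (i : ℕ)) * max (-τ) (min τ (1 - q i)) := fun _ _ => rfl
  -- growth factor and initial displacement for the band run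
  set M : ℝ := 1 + 2 * C / (1 - θ) with hM
  have hMpos : 0 < M := by
    have : 0 ≤ 2 * C / (1 - θ) := div_nonneg (by linarith) h1θ.le
    rw [hM]; linarith
  have hM1 : 1 ≤ M := by
    have : 0 ≤ 2 * C / (1 - θ) := div_nonneg (by linarith) h1θ.le
    rw [hM]; linarith
  clear_value M
  have hMN : 0 < M ^ (n + 1) := pow_pos hMpos _
  set δ₀ : ℝ := τ / (2 * M ^ (n + 1)) with hδ₀
  have hδ : 0 < δ₀ := by rw [hδ₀]; positivity
  have hN : M ^ (n + 1) * δ₀ ≤ τ / 2 := by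
    rw [hδ₀, mul_div_assoc', mul_comm (M ^ (n + 1)) τ, mul_div_mul_right _ _ hMN.ne']
  clear_value δ₀
  have hδsmall : δ₀ ≤ 3 := by
    have h1 : 1 * δ₀ ≤ M ^ (n + 1) * δ₀ := mul_le_mul_of_nonneg_right (one_le_pow₀ hM1) hδ.le
    linarith
  -- the family of forward tables of (0.20), indexed by the start
  let tbl : ℝ → ℕ → ℕ → ℝ := fun s k => Nat.rec (motive := fun _ => ℕ → ℝ) (fun _ => s)
      (fun k t i => if i ≤ k then t i else 1 / Real.sqrt (1 / (t k) ^ 2 - βt k (fun j : Fin (k + 1) => t j))) k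
  have hcs : ∀ (s : ℝ) (k i : ℕ), tbl s (k + 1) i =
      if i ≤ k then tbl s k i else 1 / Real.sqrt (1 / (tbl s k k) ^ 2 - βt k (fun j : Fin (k + 1) => tbl s k j)) :=
    fun _ _ _ => rfl
  have h0 : ∀ (s : ℝ) (i : ℕ), tbl s 0 i = s := fun _ _ => rfl
  clear_value tbl βt
  -- the band run started at s₀ = 1/√(1+δ₀) is reversed at some depth j ≤ n + 1
  obtain ⟨hs00, hs01, hs0D⟩ := start_facts hδ
  set s₀ : ℝ := 1 / Real.sqrt (1 + δ₀) with hs₀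
  clear_value s₀
  obtain ⟨hin, hrg0⟩ := clampRun hβ hC0.le hθ0.le hθ1 hτ1 hM hδ hN (hcs s₀) ((h0 s₀ 0).trans hs₀)
  have hpos0 : ∀ i, i ≤ n + 1 → 0 < tbl s₀ i i := fun i hi => (hin i hi).1
  have hband0 : ∀ i, i ≤ n + 1 → |1 - tbl s₀ i i| ≤ τ := fun i hi =>
    (abs_one_sub_le_of_inv_sq (hpos0 i hi) (by linarith)
      (((hin i hi).2.trans (mul_le_mul_of_nonneg_right (pow_le_pow_right₀ hM1 hi) hδ.le)).trans hN)).trans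
      (by linarith)
  have hrec : ∀ k, k + 1 ≤ n → 0 ≤ 1 / (tbl s₀ (k + 1) (k + 1)) ^ 2 - 1 →
      1 / (tbl s₀ (k + 2) (k + 2)) ^ 2 - 1
        ≤ p * (1 / (tbl s₀ (k + 1) (k + 1)) ^ 2 - 1) - θ * (1 / (tbl s₀ k k) ^ 2 - 1) := by
    intro k hk hDk
    have h := band_twoTerm hβ hC0.le hτ1 hrg0 hpos0 hband0 (k := k) (by omega) hDk
    have hanti := coeffLower_antitone (C := C) hC0.le hτ0.le hττ₁ (by linarith : τ₁ ≤ 1)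
    rw [hp]
    linarith [mul_le_mul_of_nonneg_right hanti hDk]
  have hD0 : 0 < 1 / (tbl s₀ 0 0) ^ 2 - 1 := by rw [h0, hs0D]; exact hδ
  obtain ⟨j, hj, hDj⟩ :=
    oscillation_fin (D := fun i => 1 / (tbl s₀ i i) ^ 2 - 1) hθ0 hp2 hn1 (fun _ => hn) hrec hD0
  have hge : 1 ≤ tbl s₀ j j := one_le_of_D_nonpos (hpos0 j hj) hDj
  -- the far start 1/2 stays below 1 at depth j
  obtain ⟨hinH, -⟩ := crudeRun hβ hC0.le hθ0.le hθ1 hτ0.le (s := 1 / 2) (by norm_num) (by norm_num)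
    hdrift34 (hcs (1 / 2)) (h0 (1 / 2) 0)
  have hlt : tbl (1 / 2) j j < 1 := by
    obtain ⟨hpH, hxH⟩ := hinH j hj
    have hjB : (j : ℝ) * (C * τ / (1 - θ)) ≤ 3 / 4 :=
      (mul_le_mul_of_nonneg_right (by exact_mod_cast hj) hB0).trans hdrift34
    have hx1 : 1 < 1 / (tbl (1 / 2) j j) ^ 2 := by
      have e : (1 : ℝ) / (1 / 2) ^ 2 = 4 := by norm_num
      rw [e] at hxH; linarith
    by_contra hge'
    have h1 : 1 ≤ tbl (1 / 2) j j := le_of_not_gt hge'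
    have h2 : 1 / (tbl (1 / 2) j j) ^ 2 ≤ 1 := by
      rw [div_le_one (by positivity)]; exact one_le_pow₀ h1
    linarith
  -- continuity of s ↦ g_j(s) on [1/2, s₀] and the intermediate value
  have hs0le1 : s₀ ≤ 1 := hs01.le
  have hhalf : (1 : ℝ) / 2 ≤ s₀ := by
    have hsq4 : Real.sqrt (1 + δ₀) ≤ 2 := by
      have h := Real.sqrt_le_sqrt (by linarith : 1 + δ₀ ≤ 4)
      rwa [show (4 : ℝ) = 2 ^ 2 by norm_num, Real.sqrt_sq (by norm_num : (0 : ℝ) ≤ 2)] at h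
    rw [hs₀]
    exact one_div_le_one_div_of_le (Real.sqrt_pos.mpr (by linarith)) hsq4
  have hcont : ContinuousOn (fun s => tbl s j j) (Icc (1 / 2 : ℝ) s₀) :=
    (tbl_continuousOn hβ hC0.le hθ0.le hθ1 hτ0.le hdrift34 hcs h0 j hj j).mono (Icc_subset_Icc_right hs0le1)
  obtain ⟨sStar, hsI, hsEq⟩ := intermediate_value_Icc hhalf hcont ⟨hlt.le, hge⟩
  -- the run from s*
  have hsS0 : 0 < sStar := by linarith [hsI.1]
  have hsS1 : sStar ≤ 1 := hsI.2.trans hs0le1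
  obtain ⟨hinS, hrgS⟩ := crudeRun hβ hC0.le hθ0.le hθ1 hτ0.le hsS0 hsS1 hdrift34 (hcs sStar) (h0 sStar 0)
  have hboxS : ∀ i, i ≤ j → 0 < tbl sStar i i ∧ tbl sStar i i ≤ 1 + τ₁ := by
    intro i hi
    obtain ⟨hpS, hxS⟩ := hinS i (hi.trans hj)
    refine ⟨hpS, le_one_add_of_inv_sq hτ₁0.le (by linarith) ?_⟩
    have hiB : (i : ℝ) * (C * τ / (1 - θ)) ≤ τ₁ :=
      (mul_le_mul_of_nonneg_right (by exact_mod_cast (hi.trans hj)) hB0).trans hdrift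
    have hs2 : 1 ≤ 1 / sStar ^ 2 := by
      rw [le_div_iff₀ (by positivity), one_mul]; exact pow_le_one₀ hsS0.le hsS1
    linarith
  refine ⟨C, 1 + τ₁, fun k i => C * θ ^ (k - i), βt, j, fun k => tbl sStar k k, fun _ => 1, hC0.le, by linarith,
    hCγ, fadingMemory_clamp hC0.le hθ0.le, histLipschitz_clamp hβ hC0.le hθ0.le _,
    fun k hk => hrgS k (lt_of_lt_of_le hk hj), rgEqH_const hβ hτ0.le _, hboxS,
    fun i _ => ⟨one_pos, by linarith⟩, ?_, ?_⟩
  · show tbl sStar 0 0 < 1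
    rw [h0]; exact lt_of_le_of_lt hsI.2 hs01
  · show tbl sStar j j = 1
    exact hsEq

/-- **THE THRESHOLD THEOREM FOR UNIQUENESS UNDER FADING MEMORY.**  For 0 < θ < 1 and any real c: «in EVERY box ]0, γ] with Cγ³ ≤ c, for EVERY β carrying `HistLipschitz Λ γ β` with
`FadingMemory C θ Λ` (C ≥ 0), two same-length in-box runs of (0.20) with the same endpoint have the same bare coupling» ⟺ **c ≤ 2(1 − √θ)²**.  ((⟸) `…Sharp.runs_eq_of_fadingMemory_sqrt`
— equivalently node U2's `T4TwoRunUniqueness.eq_of_pin_fadingMemory_rho` at ρ′ = 1∕√θ off the boundary; (⟹) contrapositive of `nonunique_above_edge`.)  Prover 1's t(θ), exactly.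
[cite: Balaban1987RG1, (0.20) p.256 with p.298 and Thm 2 p.259 («g₀ = g₀(ε, g)»)] -/
theorem uniqueBox_iff {θ c : ℝ} (hθ0 : 0 < θ) (hθ1 : θ < 1) :
    (∀ (C γ : ℝ) (Λ : ℕ → ℕ → ℝ) (β : HBeta) (K : ℕ) (g g' : ℕ → ℝ),
        0 ≤ C → C * γ ^ 3 ≤ c → FadingMemory C θ Λ → HistLipschitz Λ γ β → RGEqH K β g → RGEqH K β g' →
        (∀ i, i ≤ K → 0 < g i ∧ g i ≤ γ) → (∀ i, i ≤ K → 0 < g' i ∧ g' i ≤ γ) →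
        g K = g' K → g 0 = g' 0)
      ↔ c ≤ 2 * (1 - Real.sqrt θ) ^ 2 := by
  constructor
  · intro h
    by_contra hlt
    have hc : 2 * (1 - Real.sqrt θ) ^ 2 < c := lt_of_not_ge hlt
    obtain ⟨C, γ, Λ, β, K, g, g', hC, -, hCγ, hΛ, hL, hg, hg', hb, hb', h0, hK⟩ := nonunique_above_edge hθ0 hθ1 hc
    exact absurd (h C γ Λ β K g g' hC hCγ hΛ hL hg hg' hb hb' hK) (ne_of_lt h0)
  · intro hc C γ Λ β K g g' hC hCγ hΛ hL hg hg' hb hb' hK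
    exact runs_eq_of_fadingMemory_sqrt hθ0 hθ1 hC hg hg' hb hb' hL hΛ (hCγ.trans hc) hK 0 (Nat.zero_le _)

end

end Summit.QuantumFields.BalabanUV.Beta.EriceFlowEnclosureB12AsPrintedPointwiseFadingOrderSharpFoldEnd
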